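import Mathlib
import Summits.CriticalPhenomena.PercolationContinuityZ3.Theorems.PercNearOneGluingNoHeavyLowerTailSpiderClass
import HarnessLib

/-!
# `NoHeavyLowerTail` (stmt-CriticalPhenomena-4575) — the SPIDER CLASS in the crux's own terms: `μ(1 ≤ N_o, 2N_o ≤ |A|) ≤ 2 δ₀^{1/6} + 144 t`

Seat `prim-cplus-engine` gen 7, 2026-08-19 (`--supports stmt-CriticalPhenomena-4575`).  No definitions, no named facts, no sorries.
Sequel of `…SpiderClass.lean`.  For a spider with vertex-disjoint (connector) legs, all pairs at `o` of weight `≤ 1/2`, leg path pairs `≤ 1/2` or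
`= 1`:

* `SpiderAttach.exp_neg_two_mul_le_notAttached` — the converse companion of `notAttached_le_exp`: `e^{−2Λ} ≤ μ(o ↮ A)` (first-edge cover
  `{o ↔ A} ⊆ ⋃_x {s(o,x) open, x ↔ A off o}`, Harris for the decreasing complements, `1 − u ≥ e^{−2u}` on `[0, 1/2]`).  So for spiders
  `log(1/δ₀) ∈ [Λ, 2Λ]`: the observer's non-attachment probability and its expected attached weight are the same quantity up to a factor 2.
* `SpiderAttach.spider_smallBlock_le` — **the crux on spiders, with an explicit modulus**: if `μ(a ↮ a′) ≤ η` for all relays (IN `G`) then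
      `μ(1 ≤ N_o ∧ 2 N_o ≤ |A|) ≤ 2 · μ(o ↮ A)^{1/6} + 144 η`,
  uniformly in the number and lengths of the legs and in `|A|` — i.e. `NoHeavyLowerTail` restricted to spider observers holds with `δ = (ε/4)^6 ∧ ε/288`.
-/

namespace Summit.CriticalPhenomena.PercolationContinuityZ3.Theorems

open MeasureTheory Set
open Literature.Probability.LatticeModels (prodBernoulli prodBernoulli_real_setOf_mem prodBernoulli_real_inter_of_determinedBy
  prodBernoulli_prod_le_real_iInter_of_isLowerSet)
open Literature.Probability.Percolation

noncomputable section
open Classical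

variable {n : ℕ}

namespace SpiderAttach

/-- **`e^{−2Λ} ≤ μ(o ↮ A)`** whenever all pairs at `o` have weight `≤ 1/2` (no spider structure needed):
`Λ = Σ_{x ≠ o} w(o,x)·μ_{G∖s(o,x)}(x ↔ A)`. [this work] -/
theorem exp_neg_two_mul_le_notAttached (w : Sym2 (Fin n) → unitInterval) (A : Finset (Fin n)) (o : Fin n) (ho : o ∉ A)
    (hhalf : ∀ x : Fin n, x ≠ o → (w s(o, x) : ℝ) ≤ 1 / 2) :
    Real.exp (-(2 * ∑ x ∈ (Finset.univ.filter fun x : Fin n => x ≠ o), (w s(o, x) : ℝ) *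
        (prodBernoulli (pinW w ({s(o, x)} : Set (Sym2 (Fin n))) ∅)).real
          (⋃ a ∈ A, (openConn x a : Set (BondConfig (Fin n)))))) ≤
      (prodBernoulli w).real (⋃ a ∈ A, (openConn o a : Set (BondConfig (Fin n))))ᶜ := by
  set μ := prodBernoulli w with hμ
  set P : Finset (Fin n) := Finset.univ.filter fun x : Fin n => x ≠ o with hP
  set Uoff : Fin n → Set (BondConfig (Fin n)) := fun x => ⋃ a ∈ A, (openConnIn ({o}ᶜ : Set (Fin n)) x a) with hUoff
  set E : Fin n → Set (BondConfig (Fin n)) := fun x => {ω : BondConfig (Fin n) | s(o, x) ∈ ω} ∩ Uoff x with hE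
  have hPo : ∀ x ∈ P, x ≠ o := fun x hx => (Finset.mem_filter.1 hx).2
  -- first-edge cover
  have hcover : (⋂ x ∈ P, (E x)ᶜ) ⊆ (⋃ a ∈ A, (openConn o a : Set (BondConfig (Fin n))))ᶜ := by
    intro ω hω hoa
    rw [Set.mem_iInter₂] at hω
    rw [Set.mem_iUnion₂] at hoa
    obtain ⟨a, haA, hoa⟩ := hoa
    obtain ⟨x, hxo, hx, h1⟩ := MarkovFirstEdge.exists_open_attached_of_openConn A o ho haA hoa
    obtain ⟨a', ha'⟩ := Finset.card_pos.1 h1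
    rw [Finset.mem_filter] at ha'
    refine hω x (Finset.mem_filter.2 ⟨Finset.mem_univ _, hxo⟩) ⟨hx, ?_⟩
    simp only [hUoff, Set.mem_iUnion₂]
    exact ⟨a', ha'.1, ha'.2⟩
  -- the complements are decreasing
  have hlower : ∀ x ∈ P, IsLowerSet (E x)ᶜ := by
    intro x _ ω ω' hle hω hω'
    apply hω
    refine ⟨hle hω'.1, ?_⟩
    have h2 := hω'.2
    simp only [hUoff, Set.mem_iUnion₂] at h2 ⊢
    obtain ⟨a, ha, hxa⟩ := h2
    exact ⟨a, ha, isUpperSet_openConnIn _ x a hle hxa⟩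
  -- Harris
  have hharris : ∏ x ∈ P, μ.real (E x)ᶜ ≤ μ.real (⋂ x ∈ P, (E x)ᶜ) :=
    prodBernoulli_prod_le_real_iInter_of_isLowerSet w P hlower fun x _ => MeasurableSet.of_discrete
  -- each factor: `μ((E x)ᶜ) = 1 − w(o,x)·v°_x ≥ exp(−2 w(o,x) v_x)`
  have hfac : ∀ x ∈ P, Real.exp (-(2 * ((w s(o, x) : ℝ) *
      (prodBernoulli (pinW w ({s(o, x)} : Set (Sym2 (Fin n))) ∅)).real
        (⋃ a ∈ A, (openConn x a : Set (BondConfig (Fin n))))))) ≤ μ.real (E x)ᶜ := by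
    intro x hx
    have hxo := hPo x hx
    -- independence of the pair `s(o,x)` from the off-`o` event
    have hdet : DeterminedBy (Uoff x) (wireSet ({o}ᶜ : Set (Fin n))) := by
      rw [determinedBy_iff]
      intro ω ω' h
      have key : ∀ a, (ω ∈ openConnIn ({o}ᶜ : Set (Fin n)) x a ↔ ω' ∈ openConnIn ({o}ᶜ : Set (Fin n)) x a) :=
        fun a => (determinedBy_iff _ _).1
          (KozmaNitzan.determinedBy_openConnIn_wireSet ({o}ᶜ : Set (Fin n)) x a subset_rfl) ω ω' h
      simp only [hUoff, Set.mem_iUnion₂, key]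
    have hEx : μ.real (E x) = (w s(o, x) : ℝ) * μ.real (Uoff x) := by
      have hA' : DeterminedBy {ω : BondConfig (Fin n) | s(o, x) ∈ ω} (↑({s(o, x)} : Finset (Sym2 (Fin n))) : Set _) := by
        rw [determinedBy_iff]
        intro ω ω' h
        have := Set.ext_iff.1 h s(o, x)
        simp only [Finset.coe_singleton, mem_inter_iff, mem_singleton_iff, and_true] at this
        simp only [mem_setOf_eq, this]
      have hB' : DeterminedBy (Uoff x) (↑({s(o, x)} : Finset (Sym2 (Fin n))) : Set _)ᶜ :=
        hdet.mono fun e he heq => by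
          rw [Finset.coe_singleton, mem_singleton_iff] at heq
          subst heq
          exact (mk_mem_wireSet_iff.1 he).1 rfl
      rw [hE]
      exact (prodBernoulli_real_inter_of_determinedBy w {s(o, x)} hA' hB' MeasurableSet.of_discrete
        MeasurableSet.of_discrete).trans (by rw [prodBernoulli_real_setOf_mem])
    -- `v°_x ≤ v_x`
    have hv : μ.real (Uoff x) ≤ (prodBernoulli (pinW w ({s(o, x)} : Set (Sym2 (Fin n))) ∅)).real
        (⋃ a ∈ A, (openConn x a : Set (BondConfig (Fin n)))) := by
      rw [← ObserverUnionBoundG.real_preimage_diff_eq_pinW w _ s(o, x)]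
      refine measureReal_mono (fun ω hω => ?_) (measure_ne_top _ _)
      simp only [hUoff, Set.mem_iUnion₂] at hω
      obtain ⟨a, ha, hxa⟩ := hω
      simp only [mem_setOf_eq, Set.mem_iUnion₂]
      exact ⟨a, ha, ObserverUnionBoundG.diff_mem_openConn_of_openConnIn x hxo hxa⟩
    set u : ℝ := (w s(o, x) : ℝ) * μ.real (Uoff x) with hu
    set v : ℝ := (w s(o, x) : ℝ) * (prodBernoulli (pinW w ({s(o, x)} : Set (Sym2 (Fin n))) ∅)).real
      (⋃ a ∈ A, (openConn x a : Set (BondConfig (Fin n)))) with hvdef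
    have hw0 : 0 ≤ (w s(o, x) : ℝ) := (w _).2.1
    have huv : u ≤ v := mul_le_mul_of_nonneg_left hv hw0
    have hu0 : 0 ≤ u := mul_nonneg hw0 measureReal_nonneg
    have hv_half : v ≤ 1 / 2 := by
      have : (prodBernoulli (pinW w ({s(o, x)} : Set (Sym2 (Fin n))) ∅)).real
          (⋃ a ∈ A, (openConn x a : Set (BondConfig (Fin n)))) ≤ 1 := measureReal_le_one
      calc v ≤ (w s(o, x) : ℝ) * 1 := mul_le_mul_of_nonneg_left this hw0
        _ ≤ 1 / 2 := by rw [mul_one]; exact hhalf x hxo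
    -- `1 − u ≥ 1 − v ≥ exp(−2v)`: from `−log(1−v) ≤ 2v`
    have hpos : 0 < 1 - v := by linarith
    have hlog := Real.log_le_sub_one_of_pos (inv_pos.2 hpos)
    rw [Real.log_inv] at hlog
    have hinv : (1 - v)⁻¹ - 1 ≤ 2 * v := by
      rw [inv_eq_one_div, div_sub_one hpos.ne', div_le_iff₀ hpos]
      nlinarith [hu0]
    have hexp : Real.exp (-(2 * v)) ≤ 1 - v := by
      have h1 : -(2 * v) ≤ Real.log (1 - v) := by linarith
      calc Real.exp (-(2 * v)) ≤ Real.exp (Real.log (1 - v)) := Real.exp_le_exp.2 h1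
        _ = 1 - v := Real.exp_log hpos
    rw [probReal_compl_eq_one_sub MeasurableSet.of_discrete, hEx]
    linarith
  -- assemble
  calc Real.exp (-(2 * ∑ x ∈ P, (w s(o, x) : ℝ) *
          (prodBernoulli (pinW w ({s(o, x)} : Set (Sym2 (Fin n))) ∅)).real
            (⋃ a ∈ A, (openConn x a : Set (BondConfig (Fin n))))))
      = ∏ x ∈ P, Real.exp (-(2 * ((w s(o, x) : ℝ) *
          (prodBernoulli (pinW w ({s(o, x)} : Set (Sym2 (Fin n))) ∅)).real
            (⋃ a ∈ A, (openConn x a : Set (BondConfig (Fin n))))))) := by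
        rw [← Real.exp_sum, Finset.mul_sum, ← Finset.sum_neg_distrib]
    _ ≤ ∏ x ∈ P, μ.real (E x)ᶜ := Finset.prod_le_prod (fun x _ => (Real.exp_pos _).le) hfac
    _ ≤ μ.real (⋂ x ∈ P, (E x)ᶜ) := hharris
    _ ≤ μ.real (⋃ a ∈ A, (openConn o a : Set (BondConfig (Fin n))))ᶜ := measureReal_mono hcover (measure_ne_top _ _)

/-- **The crux on spiders (explicit modulus).**  Spider with vertex-disjoint connector legs as in `SpiderAttach.spider_lowerTail_le`
(all pairs at `o` of weight `≤ 1/2`, leg path pairs `≤ 1/2` or `= 1`).  If `μ(a ↮ a′) ≤ η` for all relays `a, a′ ∈ A` (reliability IN `G`),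
then  `μ(1 ≤ N_o ∧ 2N_o ≤ |A|) ≤ 2·μ(o ↮ A)^{1/6} + 144·η` — uniformly in the number and lengths of the legs and in `|A|`. [this work] -/
theorem spider_smallBlock_le (w : Sym2 (Fin n) → unitInterval) (A : Finset (Fin n)) (o : Fin n) (ho : o ∉ A)
    (η : ℝ) (hη : 0 ≤ η) (hhalf : ∀ x : Fin n, x ≠ o → (w s(o, x) : ℝ) ≤ 1 / 2)
    (hpair : ∀ a ∈ A, ∀ a' ∈ A, (prodBernoulli w).real (openConn a a' : Set (BondConfig (Fin n)))ᶜ ≤ η)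
    (kx : Fin n → ℕ) (px : ∀ x : Fin n, Fin (kx x + 1) → Fin n)
    (hleg : ∀ x : Fin n, x ≠ o → x ∉ A → w s(o, x) ≠ 0 →
      Function.Injective (px x) ∧ px x 0 = x ∧ (∀ i, px x i ∉ A) ∧ (∀ i, px x i ≠ o) ∧
        (∀ (i : Fin (kx x + 1)) (v : Fin n), v ∉ A → v ≠ px x i → 0 < (w s(px x i, v) : ℝ) →
          (v = o ∧ i = 0) ∨ ∃ l : Fin (kx x + 1), v = px x l ∧ (l.val = i.val + 1 ∨ i.val = l.val + 1)) ∧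
        (∀ l : Fin (kx x), (w s(px x l.castSucc, px x l.succ) : ℝ) ≤ 1 / 2 ∨ w s(px x l.castSucc, px x l.succ) = 1))
    (hdisj : ∀ x x' : Fin n, x ≠ o → x ∉ A → w s(o, x) ≠ 0 → x' ≠ o → x' ∉ A → w s(o, x') ≠ 0 → x ≠ x' →
      ∀ i i', px x i ≠ px x' i') :
    (prodBernoulli w).real {ω : BondConfig (Fin n) |
        1 ≤ (A.filter fun a => ω ∈ openConn o a).card ∧ 2 * (A.filter fun a => ω ∈ openConn o a).card ≤ A.card} ≤
      2 * ((prodBernoulli w).real (⋃ a ∈ A, (openConn o a : Set (BondConfig (Fin n))))ᶜ) ^ ((1 : ℝ) / 6) + 144 * η := by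
  set μ := prodBernoulli w with hμ
  set Λ : ℝ := ∑ x ∈ (Finset.univ.filter fun x : Fin n => x ≠ o), (w s(o, x) : ℝ) *
    (prodBernoulli (pinW w ({s(o, x)} : Set (Sym2 (Fin n))) ∅)).real
      (⋃ a ∈ A, (openConn x a : Set (BondConfig (Fin n)))) with hΛ
  set δ₀ : ℝ := μ.real (⋃ a ∈ A, (openConn o a : Set (BondConfig (Fin n))))ᶜ with hδ₀
  -- `2N ≤ |A|` iff `N ≤ |A| / 2`
  have hset : {ω : BondConfig (Fin n) | 1 ≤ (A.filter fun a => ω ∈ openConn o a).card ∧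
      2 * (A.filter fun a => ω ∈ openConn o a).card ≤ A.card} =
      {ω : BondConfig (Fin n) | 1 ≤ (A.filter fun a => ω ∈ openConn o a).card ∧
      (A.filter fun a => ω ∈ openConn o a).card ≤ A.card / 2} := by
    ext ω
    simp only [mem_setOf_eq, Nat.le_div_iff_mul_le (Nat.succ_pos 1)]
    constructor
    · rintro ⟨h1, h2⟩; exact ⟨h1, by omega⟩
    · rintro ⟨h1, h2⟩; exact ⟨h1, by omega⟩
  rw [hset]
  -- relay lightness at level `|A|/2` by pair counting
  have hlightG : ∀ a ∈ A, μ.real {ω : BondConfig (Fin n) | (A.filter fun z => ω ∈ openConn a z).card ≤ A.card / 2} ≤ 2 * η := by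
    intro a ha
    have hsb := smallBlock_le_two_mul w A a η ha (hpair a ha)
    refine (measureReal_mono (fun ω hω => ?_) (measure_ne_top _ _)).trans hsb
    simp only [mem_setOf_eq] at hω ⊢
    rw [Nat.le_div_iff_mul_le (Nat.succ_pos 1)] at hω
    omega
  have hmain := spider_lowerTail_le w A o ho (A.card / 2) (2 * η) (by positivity) hhalf hlightG kx px hleg hdisj
  -- `e^{−Λ/3} ≤ δ₀^{1/6}`
  have hlow := exp_neg_two_mul_le_notAttached w A o ho hhalf
  have hexp : Real.exp (-(Λ / 3)) ≤ δ₀ ^ ((1 : ℝ) / 6) := by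
    have h1 : Real.exp (-(Λ / 3)) = (Real.exp (-(2 * Λ))) ^ ((1 : ℝ) / 6) := by
      rw [← Real.exp_mul]; ring_nf
    rw [h1]
    exact Real.rpow_le_rpow (Real.exp_pos _).le hlow (by norm_num)
  linarith

/-- **`NoHeavyLowerTail` ON SPIDERS — the crux's statement, verbatim in shape, restricted to spider observers.**  For every `ε > 0` there is
`δ > 0` (namely `δ = min(ε/2, (ε/4)^6, ε/300)`) such that for every finite weighted graph, relay set `A`, observer `o ∉ A` which is the centre of a
spider with vertex-disjoint connector legs (pairs at `o` of weight `≤ 1/2`, leg path pairs `≤ 1/2` or `= 1`, hairs arbitrary):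
`P(o ↔ A) > 1 − δ` and `P(a ↔ a′) > 1 − δ` on `A` imply `P(1 ≤ N < (δ/ε)·E N) < ε`.  Uniform in the number and lengths of the legs. [this work] -/
theorem spider_noHeavyLowerTail : ∀ ε : ℝ, 0 < ε → ∃ δ : ℝ, 0 < δ ∧
    ∀ (n : ℕ) (w : Sym2 (Fin n) → unitInterval) (A : Finset (Fin n)) (o : Fin n), o ∉ A →
      (∀ x : Fin n, x ≠ o → (w s(o, x) : ℝ) ≤ 1 / 2) →
      ∀ (kx : Fin n → ℕ) (px : ∀ x : Fin n, Fin (kx x + 1) → Fin n),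
      (∀ x : Fin n, x ≠ o → x ∉ A → w s(o, x) ≠ 0 →
        Function.Injective (px x) ∧ px x 0 = x ∧ (∀ i, px x i ∉ A) ∧ (∀ i, px x i ≠ o) ∧
          (∀ (i : Fin (kx x + 1)) (v : Fin n), v ∉ A → v ≠ px x i → 0 < (w s(px x i, v) : ℝ) →
            (v = o ∧ i = 0) ∨ ∃ l : Fin (kx x + 1), v = px x l ∧ (l.val = i.val + 1 ∨ i.val = l.val + 1)) ∧
          (∀ l : Fin (kx x), (w s(px x l.castSucc, px x l.succ) : ℝ) ≤ 1 / 2 ∨ w s(px x l.castSucc, px x l.succ) = 1)) →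
      (∀ x x' : Fin n, x ≠ o → x ∉ A → w s(o, x) ≠ 0 → x' ≠ o → x' ∉ A → w s(o, x') ≠ 0 → x ≠ x' →
        ∀ i i', px x i ≠ px x' i') →
      1 - δ < (prodBernoulli w).real (⋃ a ∈ A, (openConn o a : Set (BondConfig (Fin n)))) →
      (∀ a ∈ A, ∀ a' ∈ A, 1 - δ < (prodBernoulli w).real (openConn a a' : Set (BondConfig (Fin n)))) →
      (prodBernoulli w).real {ω : BondConfig (Fin n) |
          1 ≤ (A.filter fun a => ω ∈ openConn o a).card ∧
          ((A.filter fun a => ω ∈ openConn o a).card : ℝ) <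
            δ * (∑ a ∈ A, (prodBernoulli w).real (openConn o a : Set (BondConfig (Fin n)))) / ε} < ε := by
  intro ε hε
  refine ⟨min (ε / 2) (min ((ε / 4) ^ 6) (ε / 300)), by positivity, ?_⟩
  intro n w A o ho hhalf kx px hleg hdisj hoA hpair
  set δ : ℝ := min (ε / 2) (min ((ε / 4) ^ 6) (ε / 300)) with hδ
  set μ := prodBernoulli w with hμ
  have hδ1 : δ ≤ ε / 2 := min_le_left _ _
  have hδ2 : δ ≤ (ε / 4) ^ 6 := (min_le_right _ _).trans (min_le_left _ _)
  have hδ3 : δ ≤ ε / 300 := (min_le_right _ _).trans (min_le_right _ _)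
  have hδ0 : 0 < δ := by positivity
  -- the crux's event lies in the small-block event
  have hEN : (∑ a ∈ A, μ.real (openConn o a : Set (BondConfig (Fin n)))) ≤ (A.card : ℝ) := by
    calc (∑ a ∈ A, μ.real (openConn o a : Set (BondConfig (Fin n)))) ≤ ∑ _a ∈ A, (1 : ℝ) :=
          Finset.sum_le_sum fun a _ => measureReal_le_one
      _ = (A.card : ℝ) := by simp
  have hsub : {ω : BondConfig (Fin n) | 1 ≤ (A.filter fun a => ω ∈ openConn o a).card ∧
      ((A.filter fun a => ω ∈ openConn o a).card : ℝ) <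
        δ * (∑ a ∈ A, μ.real (openConn o a : Set (BondConfig (Fin n)))) / ε} ⊆
      {ω : BondConfig (Fin n) | 1 ≤ (A.filter fun a => ω ∈ openConn o a).card ∧
        2 * (A.filter fun a => ω ∈ openConn o a).card ≤ A.card} := by
    rintro ω ⟨h1, h2⟩
    refine ⟨h1, ?_⟩
    have hENnn : 0 ≤ ∑ a ∈ A, μ.real (openConn o a : Set (BondConfig (Fin n))) :=
      Finset.sum_nonneg fun a _ => measureReal_nonneg
    have h3 : δ * (∑ a ∈ A, μ.real (openConn o a : Set (BondConfig (Fin n)))) / ε ≤ (A.card : ℝ) / 2 := by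
      rw [div_le_iff₀ hε]
      calc δ * (∑ a ∈ A, μ.real (openConn o a : Set (BondConfig (Fin n))))
          ≤ (ε / 2) * (A.card : ℝ) := mul_le_mul hδ1 hEN hENnn (by positivity)
        _ = (A.card : ℝ) / 2 * ε := by ring
    have h4 : ((A.filter fun a => ω ∈ openConn o a).card : ℝ) < (A.card : ℝ) / 2 := lt_of_lt_of_le h2 h3
    have h5 : (2 * (A.filter fun a => ω ∈ openConn o a).card : ℝ) < (A.card : ℝ) := by linarith
    exact_mod_cast h5.le
  -- the spider bound with `η = δ`
  have hpair' : ∀ a ∈ A, ∀ a' ∈ A, μ.real (openConn a a' : Set (BondConfig (Fin n)))ᶜ ≤ δ := by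
    intro a ha a' ha'
    rw [probReal_compl_eq_one_sub MeasurableSet.of_discrete]
    linarith [hpair a ha a' ha']
  have hmain := spider_smallBlock_le w A o ho δ hδ0.le hhalf hpair' kx px hleg hdisj
  -- `δ₀ < δ ≤ (ε/4)^6`, so `δ₀^{1/6} ≤ ε/4`
  have hδ₀ : μ.real (⋃ a ∈ A, (openConn o a : Set (BondConfig (Fin n))))ᶜ ≤ (ε / 4) ^ (6 : ℕ) := by
    rw [probReal_compl_eq_one_sub MeasurableSet.of_discrete]
    linarith
  have hroot : (μ.real (⋃ a ∈ A, (openConn o a : Set (BondConfig (Fin n))))ᶜ) ^ ((1 : ℝ) / 6) ≤ ε / 4 := by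
    calc (μ.real (⋃ a ∈ A, (openConn o a : Set (BondConfig (Fin n))))ᶜ) ^ ((1 : ℝ) / 6)
        ≤ ((ε / 4) ^ (6 : ℕ)) ^ ((1 : ℝ) / 6) := Real.rpow_le_rpow measureReal_nonneg hδ₀ (by norm_num)
      _ = ε / 4 := by
          rw [one_div, show ((6 : ℝ))⁻¹ = ((6 : ℕ) : ℝ)⁻¹ by norm_num]
          exact Real.pow_rpow_inv_natCast (by positivity) (by norm_num)
  calc μ.real {ω : BondConfig (Fin n) | 1 ≤ (A.filter fun a => ω ∈ openConn o a).card ∧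
          ((A.filter fun a => ω ∈ openConn o a).card : ℝ) <
            δ * (∑ a ∈ A, μ.real (openConn o a : Set (BondConfig (Fin n)))) / ε}
      ≤ μ.real {ω : BondConfig (Fin n) | 1 ≤ (A.filter fun a => ω ∈ openConn o a).card ∧
          2 * (A.filter fun a => ω ∈ openConn o a).card ≤ A.card} := measureReal_mono hsub (measure_ne_top _ _)
    _ ≤ 2 * (μ.real (⋃ a ∈ A, (openConn o a : Set (BondConfig (Fin n))))ᶜ) ^ ((1 : ℝ) / 6) + 144 * δ := hmain
    _ < ε := by nlinarith

end SpiderAttach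

end

end Summit.CriticalPhenomena.PercolationContinuityZ3.Theorems
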